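import Literature.Analysis.FluidPDE.PressureHarmonicPartL3
import Mathlib.MeasureTheory.Integral.Average
import HarnessLib

/-!
# From ball averages to probe weights: `⨍_{B(c,ρ)} h → 0` at every centre implies
# `∫ χ_R(c − y) h(y) dy → 0` and `∫ (χ_R ⋆ θ)(x₁ − y) h(y) dy → 0`

Analysis/FluidPDE support file (all results proved; no definitions, no named facts). Tao's
pressure-normalisation argument (Tao 2011, §4, proof of Lemma 4.1 (i); tree `HarmonicProbe`,
`PressureHarmonicPartL3`) tests the momentum equation against the dilated radial bumps
`χ_R = probeBump R` and their mollifications `χ_R ⋆ θ`. For BOUNDED velocities the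
time-derivative term is controlled by conservation of momentum at spatial infinity, which the
tree supplies in BALL-AVERAGE form (`tendsto_setAverage_oseenDuhamel`, `⨍_{B_ρ} (…) → 0`). This
file converts ball averages into probe weights by the layer-cake formula for the radial profile
`F(σ) = smoothTransition((4 − σ)/2)` of the base bump (`baseBump x = F(|x|²)`):

  `F(s) = ∫ 1_{(0,4]}(σ) 1_{(s,∞)}(σ) (−F′(σ)) dσ`  (`s ≥ 0`; `F(4) = 0`, FTC),

so that `∫ χ_R(c − y) h(y) dy = ∫ 1_{(0,4]}(σ) m⁻¹ V₁ (−F′(σ)) √σ³ · ⨍_{B(c, R√σ)} h dσ`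
(Fubini), and dominated convergence in `σ`:

`tendsto_integral_probeBump_smul` (`∫ χ_R(c − y) h(y) dy → 0` for bounded continuous `h` with
`⨍_{B(c,ρ)} h → 0`) and `tendsto_integral_probeConv_smul` (the mollified probes `(χ_R ⋆ θ)(x₁ − ·)`,
ball averages tending to `0` at every centre; Fubini in the mollification variable).
Reference: T. Tao, Anal. PDE 6 (2013) = arXiv:1108.1165, §4, proof of Lemma 4.1 (i) (the probes
`R⁻³χ(x/R)`) [Tao2011]. Tree: `probeBump`, `baseBump`, `integral_probeBump` (`HarmonicProbe`); Mathlib: `integral_integral_swap`,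
`Integrable.integral_prod_right`, `tendsto_integral_filter_of_dominated_convergence`.
-/

noncomputable section

open MeasureTheory Set Filter Metric Topology Function
open scoped RealInnerProductSpace ENNReal Convolution

namespace Literature.Analysis.FluidPDE

namespace ProbeWeight

variable {F : Type*} [NormedAddCommGroup F] [NormedSpace ℝ F] [CompleteSpace F]

/-! ### The radial profile of the base bump and its layer-cake representation -/

/-- The base bump is the profile `σ ↦ smoothTransition((2² − σ)/(1·2))` of `|x|²`. [folklore] -/
private theorem baseBump_eq_profile (x : EuclideanSpace ℝ (Fin 3)) :
    baseBump x = (fun σ : ℝ => Real.smoothTransition ((2 ^ 2 - σ) / (1 * 2))) (‖x‖ ^ 2) := by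
  simp only [baseBump, taoCutoff_apply]

/-- **Layer cake for the profile**: with `F(σ) = smoothTransition((4 − σ)/2)`,
`F(s) = ∫ 1_{(0,4]}(σ) (−F′(σ)) · 1_{(s,∞)}(σ) dσ` for every `s ≥ 0` (`F(4) = 0`, FTC). [folklore] -/
private theorem profile_eq_integral {s : ℝ} (hs : 0 ≤ s) :
    (fun σ : ℝ => Real.smoothTransition ((2 ^ 2 - σ) / (1 * 2))) s =
      ∫ σ, (Ioc (0 : ℝ) 4).indicator
        (fun σ => -deriv (fun σ : ℝ => Real.smoothTransition ((2 ^ 2 - σ) / (1 * 2))) σ) σ *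
        (Ioi s).indicator (fun _ => (1 : ℝ)) σ := by
  set Fp : ℝ → ℝ := fun σ => Real.smoothTransition ((2 ^ 2 - σ) / (1 * 2)) with hFp
  have hFd : ContDiff ℝ 1 Fp :=
    Real.smoothTransition.contDiff.comp ((contDiff_const.sub contDiff_id).div_const _)
  have hF4 : ∀ σ, 4 ≤ σ → Fp σ = 0 := fun σ hσ =>
    Real.smoothTransition.zero_of_nonpos (div_nonpos_of_nonpos_of_nonneg (by nlinarith) (by norm_num))
  have hGc : Continuous (deriv Fp) := hFd.continuous_deriv le_rfl
  have hind : (fun σ => (Ioc (0 : ℝ) 4).indicator (fun σ => -deriv Fp σ) σ * (Ioi s).indicator (fun _ => (1 : ℝ)) σ) =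
      (Ioc (0 : ℝ) 4 ∩ Ioi s).indicator (fun σ => -deriv Fp σ) := by
    funext σ
    by_cases h1 : σ ∈ Ioi s
    · by_cases h2 : σ ∈ Ioc (0 : ℝ) 4
      · rw [indicator_of_mem h1, indicator_of_mem h2, indicator_of_mem (mem_inter h2 h1), mul_one]
      · rw [indicator_of_notMem h2,
          indicator_of_notMem (show σ ∉ Ioc (0 : ℝ) 4 ∩ Ioi s from fun h => h2 h.1), zero_mul]
    · rw [indicator_of_notMem h1,
        indicator_of_notMem (show σ ∉ Ioc (0 : ℝ) 4 ∩ Ioi s from fun h => h1 h.2), mul_zero]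
  change Fp s = _
  rw [hind, integral_indicator (measurableSet_Ioc.inter measurableSet_Ioi)]
  by_cases hs4 : s ≤ 4
  · have hset : Ioc (0 : ℝ) 4 ∩ Ioi s = Ioc s 4 := by
      ext σ; simp only [mem_inter_iff, mem_Ioc, mem_Ioi]; constructor
      · rintro ⟨⟨-, h2⟩, h3⟩; exact ⟨h3, h2⟩
      · rintro ⟨h1, h2⟩; exact ⟨⟨hs.trans_lt h1, h2⟩, h1⟩
    rw [hset, ← intervalIntegral.integral_of_le hs4, intervalIntegral.integral_neg,
      intervalIntegral.integral_deriv_eq_sub (fun σ _ => hFd.differentiable one_ne_zero σ)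
        (hGc.intervalIntegrable _ _), hF4 4 le_rfl]
    ring
  · rw [not_le] at hs4
    have hset : Ioc (0 : ℝ) 4 ∩ Ioi s = ∅ := by
      ext σ; simp only [mem_inter_iff, mem_Ioc, mem_Ioi, mem_empty_iff_false, iff_false, not_and,
        not_lt, and_imp]
      intro _ h2; linarith
    rw [hset, Measure.restrict_empty, integral_zero_measure]
    exact hF4 s hs4.le

/-! ### Ball averages ⇒ probe weights -/

/-- The volume of a ball in `ℝ³` (real form): `|B(c, r)| = r³ |B(0,1)|` for `r > 0`. [folklore] -/
private theorem volume_real_ball (c : EuclideanSpace ℝ (Fin 3)) {r : ℝ} (hr : 0 < r) :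
    (volume : Measure (EuclideanSpace ℝ (Fin 3))).real (ball c r) =
      r ^ 3 * (volume : Measure (EuclideanSpace ℝ (Fin 3))).real (ball 0 1) := by
  have hd : Module.finrank ℝ (EuclideanSpace ℝ (Fin 3)) = 3 := finrank_euclideanSpace_fin
  rw [measureReal_def, Measure.addHaar_ball_of_pos volume c hr, hd, ENNReal.toReal_mul,
    ENNReal.toReal_ofReal (by positivity), measureReal_def]

omit [CompleteSpace F] in
/-- The norm of a ball average of a function bounded by `M ≥ 0` is at most `M`. [folklore] -/
private theorem norm_setAverage_ball_le {h : EuclideanSpace ℝ (Fin 3) → F} {M : ℝ} (hM0 : 0 ≤ M)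
    (hM : ∀ y, ‖h y‖ ≤ M) (c : EuclideanSpace ℝ (Fin 3)) (r : ℝ) :
    ‖⨍ y in ball c r, h y‖ ≤ M := by
  rw [setAverage_eq, norm_smul, norm_inv, Real.norm_eq_abs, abs_of_nonneg measureReal_nonneg]
  by_cases h0 : (volume : Measure (EuclideanSpace ℝ (Fin 3))).real (ball c r) = 0
  · rw [h0, inv_zero, zero_mul]; exact hM0
  · have hpos : 0 < (volume : Measure (EuclideanSpace ℝ (Fin 3))).real (ball c r) :=
      lt_of_le_of_ne measureReal_nonneg (Ne.symm h0)
    have hb := norm_setIntegral_le_of_norm_le_const (measure_ball_lt_top (μ := volume) (x := c) (r := r))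
      (fun y _ => hM y) (f := h)
    rw [inv_mul_le_iff₀ hpos]
    linarith

/-- **From ball averages to the probes `χ_R`.** If `h` is bounded and continuous and its averages
over the balls centred at `c` tend to `0` as the radius tends to `∞`, then
`∫ χ_R(c − y) h(y) dy → 0` as `R → ∞` (`χ_R = probeBump R`, Tao's `R⁻³χ(x/R)`).
[cite: Tao2011, §4, proof of Lemma 4.1 (i)] -/
theorem tendsto_integral_probeBump_smul {h : EuclideanSpace ℝ (Fin 3) → F} (hc : Continuous h)
    {M : ℝ} (hM : ∀ y, ‖h y‖ ≤ M) (c : EuclideanSpace ℝ (Fin 3))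
    (hav : Tendsto (fun ρ : ℝ => ⨍ y in ball c ρ, h y) atTop (𝓝 0)) :
    Tendsto (fun R : ℝ => ∫ y, probeBump R (c - y) • h y) atTop (𝓝 0) := by
  have hd : Module.finrank ℝ (EuclideanSpace ℝ (Fin 3)) = 3 := finrank_euclideanSpace_fin
  have hM0 : 0 ≤ M := (norm_nonneg _).trans (hM 0)
  -- the profile and `G = −F′`
  set Fp : ℝ → ℝ := fun σ => Real.smoothTransition ((2 ^ 2 - σ) / (1 * 2)) with hFp
  set G : ℝ → ℝ := fun σ => -deriv Fp σ with hG
  have hFd : ContDiff ℝ 1 Fp :=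
    Real.smoothTransition.contDiff.comp ((contDiff_const.sub contDiff_id).div_const _)
  have hGc : Continuous G := (hFd.continuous_deriv le_rfl).neg
  obtain ⟨S, hS⟩ := (isCompact_Icc : IsCompact (Icc (0 : ℝ) 4)).exists_bound_of_continuousOn
    hGc.continuousOn
  have hS0 : 0 ≤ S := (norm_nonneg _).trans (hS 0 (by simp))
  set m : ℝ := baseBumpMass (EuclideanSpace ℝ (Fin 3)) with hm
  have hm0 : 0 < m := baseBumpMass_pos
  set V₁ : ℝ := (volume : Measure (EuclideanSpace ℝ (Fin 3))).real (ball 0 1) with hV₁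
  have hV₁0 : 0 ≤ V₁ := measureReal_nonneg
  -- the time weight `w σ = 1_{(0,4]}(σ) G(σ)` and the two-variable integrand
  set w : ℝ → ℝ := fun σ => (Ioc (0 : ℝ) 4).indicator G σ with hw
  have hsq2 : ∀ σ ∈ Ioc (0 : ℝ) 4, Real.sqrt σ ≤ 2 := fun σ hσ => by
    rw [show (2 : ℝ) = Real.sqrt (2 ^ 2) by rw [Real.sqrt_sq]; norm_num]
    exact Real.sqrt_le_sqrt (by linarith [hσ.2])
  have hw0 : ∀ σ, σ ∉ Ioc (0 : ℝ) 4 → w σ = 0 := fun σ hσ => by simp only [hw, indicator_of_notMem hσ]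
  have hwb : ∀ σ, ‖w σ‖ ≤ S := fun σ => by
    by_cases hσ : σ ∈ Ioc (0 : ℝ) 4
    · simp only [hw, indicator_of_mem hσ]; exact hS σ ⟨hσ.1.le, hσ.2⟩
    · rw [hw0 σ hσ, norm_zero]; exact hS0
  have hwm : Measurable w := (hGc.measurable).indicator measurableSet_Ioc
  set f : ℝ → EuclideanSpace ℝ (Fin 3) × ℝ → F := fun R p =>
    (w p.2 * (ball c (R * Real.sqrt p.2)).indicator (fun _ => (1 : ℝ)) p.1) • h p.1 with hf
  -- Step 1: `f R` is integrable on the product (bounded, measurable, compact support)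
  have hfi : ∀ R, 0 < R →
      Integrable (f R) ((volume : Measure (EuclideanSpace ℝ (Fin 3))).prod (volume : Measure ℝ)) := by
    intro R hR
    have hset : MeasurableSet {p : EuclideanSpace ℝ (Fin 3) × ℝ | dist p.1 c < R * Real.sqrt p.2} :=
      measurableSet_lt (continuous_fst.dist continuous_const).measurable
        (continuous_const.mul (Real.continuous_sqrt.comp continuous_snd)).measurable
    have h1 : Measurable fun p : EuclideanSpace ℝ (Fin 3) × ℝ =>
        (ball c (R * Real.sqrt p.2)).indicator (fun _ => (1 : ℝ)) p.1 := by
      have : (fun p : EuclideanSpace ℝ (Fin 3) × ℝ => (ball c (R * Real.sqrt p.2)).indicator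
          (fun _ => (1 : ℝ)) p.1) = {p | dist p.1 c < R * Real.sqrt p.2}.indicator 1 := by
        funext p; simp only [indicator, mem_ball, mem_setOf_eq, Pi.one_apply]
      rw [this]; exact measurable_one.indicator hset
    have hmeas : AEStronglyMeasurable (f R)
        ((volume : Measure (EuclideanSpace ℝ (Fin 3))).prod (volume : Measure ℝ)) :=
      (((hwm.comp measurable_snd).mul h1).aestronglyMeasurable).smul
        (hc.comp continuous_fst).aestronglyMeasurable
    -- support in `closedBall c (2R) ×ˢ Icc 0 4`
    set K : Set (EuclideanSpace ℝ (Fin 3) × ℝ) := closedBall c (2 * R) ×ˢ Icc (0 : ℝ) 4 with hK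
    have hsupp : ∀ p, p ∉ K → f R p = 0 := by
      intro p hp
      by_cases hσ : p.2 ∈ Ioc (0 : ℝ) 4
      · have hy : p.1 ∉ ball c (R * Real.sqrt p.2) := fun hy => hp ⟨by
          rw [mem_ball] at hy; rw [mem_closedBall]; nlinarith [hsq2 p.2 hσ], ⟨hσ.1.le, hσ.2⟩⟩
        simp only [hf, indicator_of_notMem hy, mul_zero, zero_smul]
      · simp only [hf, hw0 p.2 hσ, zero_mul, zero_smul]
    have hKm : ((volume : Measure (EuclideanSpace ℝ (Fin 3))).prod (volume : Measure ℝ)) K < ⊤ := by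
      rw [hK, Measure.prod_prod]; exact ENNReal.mul_lt_top measure_closedBall_lt_top measure_Icc_lt_top
    have hbound : ∀ p, ‖f R p‖ ≤ S * M := fun p => by
      simp only [hf, norm_smul, norm_mul]
      have hi : ‖(ball c (R * Real.sqrt p.2)).indicator (fun _ => (1 : ℝ)) p.1‖ ≤ 1 := by
        by_cases hy : p.1 ∈ ball c (R * Real.sqrt p.2) <;> simp [hy]
      calc ‖w p.2‖ * ‖(ball c (R * Real.sqrt p.2)).indicator (fun _ => (1 : ℝ)) p.1‖ * ‖h p.1‖
          ≤ S * 1 * M := by gcongr; exacts [hwb _, hM _]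
        _ = S * M := by ring
    have hon : IntegrableOn (f R) K ((volume : Measure (EuclideanSpace ℝ (Fin 3))).prod volume) :=
      Measure.integrableOn_of_bounded hKm.ne hmeas (ae_of_all _ fun p => hbound p)
    exact hon.integrable_of_forall_notMem_eq_zero hsupp
  -- Step 2: the identity `∫ χ_R(c−y) h = ∫ σ, (m R³)⁻¹ • ∫ y, f R (y, σ)` for `R > 0`
  have hlayer : ∀ R, 0 < R → ∀ y : EuclideanSpace ℝ (Fin 3),
      probeBump R (c - y) = (m * R ^ 3)⁻¹ * ∫ σ, w σ * (ball c (R * Real.sqrt σ)).indicator (fun _ => (1 : ℝ)) y := by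
    intro R hR y
    have hs : 0 ≤ ‖c - y‖ ^ 2 / R ^ 2 := by positivity
    have key := profile_eq_integral hs
    rw [probeBump, hd, baseBump_eq_profile, norm_smul, norm_inv, Real.norm_eq_abs, abs_of_pos hR,
      show (R⁻¹ * ‖c - y‖) ^ 2 = ‖c - y‖ ^ 2 / R ^ 2 by field_simp, key]
    congr 1
    refine integral_congr_ae (Eventually.of_forall fun σ => ?_)
    simp only [hw]
    by_cases hσ : σ ∈ Ioc (0 : ℝ) 4
    · simp only [indicator_of_mem hσ]
      congr 1
      -- `σ > s ↔ y ∈ ball c (R √σ)`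
      have hσ0 : 0 < σ := hσ.1
      by_cases hy : y ∈ ball c (R * Real.sqrt σ)
      · rw [indicator_of_mem hy, indicator_of_mem]
        rw [mem_Ioi, div_lt_iff₀ (by positivity)]
        rw [mem_ball, dist_eq_norm, norm_sub_rev] at hy
        have h1 : ‖c - y‖ ^ 2 < (R * Real.sqrt σ) ^ 2 := by
          exact pow_lt_pow_left₀ hy (norm_nonneg _) two_ne_zero
        rw [mul_pow, Real.sq_sqrt hσ0.le] at h1
        linarith [mul_comm (R ^ 2) σ]
      · rw [indicator_of_notMem hy, indicator_of_notMem]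
        rw [mem_Ioi, not_lt, le_div_iff₀ (by positivity)]
        rw [mem_ball, dist_eq_norm, norm_sub_rev, not_lt] at hy
        have h1 : (R * Real.sqrt σ) ^ 2 ≤ ‖c - y‖ ^ 2 :=
          pow_le_pow_left₀ (by positivity) hy 2
        rw [mul_pow, Real.sq_sqrt hσ0.le] at h1
        linarith [mul_comm (R ^ 2) σ]
    · simp only [indicator_of_notMem hσ, zero_mul]
  have hident : ∀ R, 0 < R →
      ∫ y, probeBump R (c - y) • h y = ∫ σ, (m * R ^ 3)⁻¹ • ∫ y, f R (y, σ) := by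
    intro R hR
    have e1 : (fun y => probeBump R (c - y) • h y) =
        fun y => (m * R ^ 3)⁻¹ • ∫ σ, f R (y, σ) := by
      funext y
      rw [hlayer R hR y, mul_smul, ← integral_smul_const]
    rw [e1, integral_smul, integral_integral_swap (hfi R hR), ← integral_smul]
  -- Step 3: the inner integral as a scaled ball average, and the bounds
  have hinner : ∀ R, 0 < R → ∀ σ, σ ∈ Ioc (0 : ℝ) 4 →
      (m * R ^ 3)⁻¹ • ∫ y, f R (y, σ) =
        (m⁻¹ * V₁ * G σ * Real.sqrt σ ^ 3) • ⨍ y in ball c (R * Real.sqrt σ), h y := by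
    intro R hR σ hσ
    have hr : 0 < R * Real.sqrt σ := mul_pos hR (Real.sqrt_pos.2 hσ.1)
    have e1 : (fun y => f R (y, σ)) = fun y => (ball c (R * Real.sqrt σ)).indicator (fun y => G σ • h y) y := by
      funext y
      simp only [hf, hw, indicator_of_mem hσ]
      by_cases hy : y ∈ ball c (R * Real.sqrt σ) <;> simp [hy]
    rw [e1, integral_indicator measurableSet_ball, integral_smul,
      ← measure_smul_setAverage _ (measure_ball_lt_top (μ := volume)).ne, volume_real_ball c hr,
      smul_smul, smul_smul]
    congr 1
    field_simp
    ring
  have hbd : ∀ R, 0 < R → ∀ σ, ‖(m * R ^ 3)⁻¹ • ∫ y, f R (y, σ)‖ ≤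
      (Ioc (0 : ℝ) 4).indicator (fun _ => m⁻¹ * V₁ * S * 8 * M) σ := by
    intro R hR σ
    by_cases hσ : σ ∈ Ioc (0 : ℝ) 4
    · rw [hinner R hR σ hσ, indicator_of_mem hσ, norm_smul]
      have hsq : Real.sqrt σ ≤ 2 := hsq2 σ hσ
      have hsq0 : 0 ≤ Real.sqrt σ := Real.sqrt_nonneg σ
      have hG' : |G σ| ≤ S := by
        have := hS σ ⟨hσ.1.le, hσ.2⟩; rwa [Real.norm_eq_abs] at this
      calc ‖m⁻¹ * V₁ * G σ * Real.sqrt σ ^ 3‖ * ‖⨍ y in ball c (R * Real.sqrt σ), h y‖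
          ≤ (m⁻¹ * V₁ * S * 8) * M := by
            refine mul_le_mul ?_ (norm_setAverage_ball_le hM0 hM c _) (norm_nonneg _) (by positivity)
            rw [Real.norm_eq_abs, abs_mul, abs_mul, abs_mul, abs_of_pos (inv_pos.2 hm0),
              abs_of_nonneg hV₁0, abs_of_nonneg (pow_nonneg hsq0 3)]
            have h8 : Real.sqrt σ ^ 3 ≤ 8 := by
              have := pow_le_pow_left₀ hsq0 hsq 3; norm_num at this; exact this
            gcongr
        _ = m⁻¹ * V₁ * S * 8 * M := by ring
    · have e1 : (fun y => f R (y, σ)) = fun _ => 0 := funext fun y => by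
        simp only [hf, hw0 σ hσ, zero_mul, zero_smul]
      rw [e1, integral_zero, smul_zero, norm_zero, indicator_of_notMem hσ]
  -- Step 4: dominated convergence in `σ`
  have hlim : Tendsto (fun R : ℝ => ∫ σ, (m * R ^ 3)⁻¹ • ∫ y, f R (y, σ)) atTop (𝓝 (∫ σ : ℝ, (0 : F))) := by
    refine tendsto_integral_filter_of_dominated_convergence
      (fun σ => (Ioc (0 : ℝ) 4).indicator (fun _ => m⁻¹ * V₁ * S * 8 * M) σ) ?_ ?_ ?_ ?_
    · filter_upwards [eventually_gt_atTop (0 : ℝ)] with R hR using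
        ((hfi R hR).integral_prod_right.aestronglyMeasurable).const_smul _
    · filter_upwards [eventually_gt_atTop (0 : ℝ)] with R hR using Eventually.of_forall (hbd R hR)
    · exact (integrable_indicator_iff measurableSet_Ioc).2 (integrableOn_const measure_Ioc_lt_top.ne)
    · refine Eventually.of_forall fun σ => ?_
      by_cases hσ : σ ∈ Ioc (0 : ℝ) 4
      · have hsq : 0 < Real.sqrt σ := Real.sqrt_pos.2 hσ.1
        have h1 : Tendsto (fun R : ℝ => ⨍ y in ball c (R * Real.sqrt σ), h y) atTop (𝓝 0) :=
          hav.comp (tendsto_id.atTop_mul_const hsq)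
        refine (by simpa using h1.const_smul (m⁻¹ * V₁ * G σ * Real.sqrt σ ^ 3) :
          Tendsto (fun R : ℝ => (m⁻¹ * V₁ * G σ * Real.sqrt σ ^ 3) •
            ⨍ y in ball c (R * Real.sqrt σ), h y) atTop (𝓝 0)).congr' ?_
        filter_upwards [eventually_gt_atTop (0 : ℝ)] with R hR using (hinner R hR σ hσ).symm
      · have : (fun R : ℝ => (m * R ^ 3)⁻¹ • ∫ y, f R (y, σ)) = fun _ => 0 := funext fun R => by
          have e1 : (fun y => f R (y, σ)) = fun _ => 0 := funext fun y => by
            simp only [hf, hw0 σ hσ, zero_mul, zero_smul]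
          rw [e1, integral_zero, smul_zero]
        rw [this]; exact tendsto_const_nhds
  rw [integral_zero] at hlim
  refine hlim.congr' ?_
  filter_upwards [eventually_gt_atTop (0 : ℝ)] with R hR using (hident R hR).symm

omit [CompleteSpace F] in
/-- `∫ χ_R(c − y) dy = 1`, so the weighted integral of a function bounded by `M` has norm at
most `M`. [folklore] -/
private theorem norm_integral_probeBump_smul_le {h : EuclideanSpace ℝ (Fin 3) → F}
    {M : ℝ} (hM : ∀ y, ‖h y‖ ≤ M) (c : EuclideanSpace ℝ (Fin 3)) {R : ℝ}
    (hR : 0 < R) : ‖∫ y, probeBump R (c - y) • h y‖ ≤ M := by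
  have hint : Integrable (fun y => probeBump R (c - y)) :=
    (integrable_probeBump (E := EuclideanSpace ℝ (Fin 3)) hR).comp_sub_left c
  have h1 : ∫ y, probeBump R (c - y) = 1 := by
    rw [integral_sub_left_eq_self (probeBump R) volume c]; exact integral_probeBump hR
  calc ‖∫ y, probeBump R (c - y) • h y‖ ≤ ∫ y, probeBump R (c - y) * M := by
        refine norm_integral_le_of_norm_le (hint.mul_const M) (Eventually.of_forall fun y => ?_)
        rw [norm_smul, Real.norm_eq_abs, abs_of_nonneg (probeBump_nonneg hR _)]
        exact mul_le_mul_of_nonneg_left (hM y) (probeBump_nonneg hR _)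
    _ = M := by rw [integral_mul_const, h1, one_mul]

/-- **From ball averages to the mollified probes `χ_R ⋆ θ`.** If `h` is bounded and continuous
and `⨍_{B(c,ρ)} h → 0` as `ρ → ∞` for EVERY centre `c`, then for every normed bump `θ` and
every `x₁`, `∫ (χ_R ⋆ θ)(x₁ − y) h(y) dy → 0` as `R → ∞` (the test functions
`Φ = χ_R ⋆ θ` of Tao's probe identity). [cite: Tao2011, §4, proof of Lemma 4.1 (i)] -/
theorem tendsto_integral_probeConv_smul {h : EuclideanSpace ℝ (Fin 3) → F} (hc : Continuous h)
    {M : ℝ} (hM : ∀ y, ‖h y‖ ≤ M)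
    (hav : ∀ c : EuclideanSpace ℝ (Fin 3), Tendsto (fun ρ : ℝ => ⨍ y in ball c ρ, h y) atTop (𝓝 0))
    (φ : ContDiffBump (0 : EuclideanSpace ℝ (Fin 3))) (x₁ : EuclideanSpace ℝ (Fin 3)) :
    Tendsto (fun R : ℝ => ∫ y, (probeBump R ⋆ φ.normed volume) (x₁ - y) • h y) atTop (𝓝 0) := by
  have hM0 : 0 ≤ M := (norm_nonneg _).trans (hM 0)
  set θ := φ.normed volume with hθ
  have hθc : Continuous θ := φ.continuous_normed
  have hθi : Integrable θ := φ.integrable_normed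
  have hθ0 : ∀ z, 0 ≤ θ z := φ.nonneg_normed
  -- `(χ_R ⋆ θ)(w) = ∫ z, χ_R(w − z) θ(z) dz`
  have hconv : ∀ R w, (probeBump R ⋆ θ) w = ∫ z, probeBump R (w - z) * θ z := fun R w => by
    rw [convolution_lsmul_swap]; rfl
  -- Step 1: Fubini in `(y, z)` for `R > 0`
  have hident : ∀ R, 0 < R → ∫ y, (probeBump R ⋆ θ) (x₁ - y) • h y =
      ∫ z, θ z • ∫ y, probeBump R ((x₁ - z) - y) • h y := by
    intro R hR
    set g : EuclideanSpace ℝ (Fin 3) → EuclideanSpace ℝ (Fin 3) → F :=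
      fun y z => (probeBump R (x₁ - y - z) * θ z) • h y with hg
    have hgc : Continuous (uncurry g) :=
      ((((contDiff_probeBump R (n := 0)).continuous.comp
        ((continuous_const.sub continuous_fst).sub continuous_snd)).mul
        (hθc.comp continuous_snd)).smul (hc.comp continuous_fst))
    have hgs : HasCompactSupport (uncurry g) := by
      refine HasCompactSupport.intro ((isCompact_closedBall x₁ (2 * R + φ.rOut)).prod
        (isCompact_closedBall (0 : EuclideanSpace ℝ (Fin 3)) φ.rOut)) fun p hp => ?_
      rw [Set.mem_prod, not_and_or] at hp
      simp only [uncurry, hg]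
      rcases hp with hp | hp
      · by_cases hz : p.2 ∈ closedBall (0 : EuclideanSpace ℝ (Fin 3)) φ.rOut
        · rw [mem_closedBall, dist_zero_right] at hz
          rw [mem_closedBall, dist_eq_norm, not_le] at hp
          have hfar : 2 * R ≤ ‖x₁ - p.1 - p.2‖ := by
            have := norm_sub_norm_le (x₁ - p.1) p.2
            rw [norm_sub_rev p.1 x₁] at hp
            linarith
          rw [probeBump_eq_zero hR hfar, zero_mul, zero_smul]
        · rw [mem_closedBall, dist_zero_right, not_le] at hz
          rw [show θ p.2 = 0 from PressureNormalisationL3.normed_eq_zero_of_lt φ hz, mul_zero, zero_smul]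
      · rw [mem_closedBall, dist_zero_right, not_le] at hp
        rw [show θ p.2 = 0 from PressureNormalisationL3.normed_eq_zero_of_lt φ hp, mul_zero, zero_smul]
    have hgi : Integrable (uncurry g) ((volume : Measure (EuclideanSpace ℝ (Fin 3))).prod volume) :=
      hgc.integrable_of_hasCompactSupport hgs
    calc ∫ y, (probeBump R ⋆ θ) (x₁ - y) • h y = ∫ y, ∫ z, g y z := by
          refine integral_congr_ae (Eventually.of_forall fun y => ?_)
          simp only [hg, hconv R (x₁ - y), ← integral_smul_const]
      _ = ∫ z, ∫ y, g y z := integral_integral_swap hgi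
      _ = ∫ z, θ z • ∫ y, probeBump R ((x₁ - z) - y) • h y := by
          refine integral_congr_ae (Eventually.of_forall fun z => ?_)
          simp only [hg, ← integral_smul]
          refine integral_congr_ae (Eventually.of_forall fun y => ?_)
          show (probeBump R (x₁ - y - z) * θ z) • h y = θ z • probeBump R (x₁ - z - y) • h y
          rw [smul_smul, mul_comm (θ z), sub_right_comm]
  -- Step 2: dominated convergence in `z`
  have hlim : Tendsto (fun R : ℝ => ∫ z, θ z • ∫ y, probeBump R ((x₁ - z) - y) • h y) atTop
      (𝓝 (∫ z : EuclideanSpace ℝ (Fin 3), (0 : F))) := by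
    refine tendsto_integral_filter_of_dominated_convergence (fun z => θ z * M) ?_ ?_ (hθi.mul_const M) ?_
    · filter_upwards [eventually_gt_atTop (0 : ℝ)] with R hR
      have hk : Continuous fun z => ∫ y, probeBump R ((x₁ - z) - y) • h y := by
        have h2 : Continuous fun w => ∫ y, probeBump R y • h (w - y) :=
          continuous_integral_smul_comp_sub (integrable_probeBump hR)
            (fun z hz => probeBump_eq_zero hR hz.le) hc
        have e : (fun z => ∫ y, probeBump R ((x₁ - z) - y) • h y) =
            fun z => ∫ y, probeBump R y • h ((x₁ - z) - y) := by
          funext z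
          rw [← integral_sub_left_eq_self (fun y => probeBump R y • h ((x₁ - z) - y)) volume (x₁ - z)]
          simp only [sub_sub_cancel]
        rw [e]
        exact h2.comp (continuous_const.sub continuous_id)
      exact (hθc.aestronglyMeasurable.smul hk.aestronglyMeasurable)
    · filter_upwards [eventually_gt_atTop (0 : ℝ)] with R hR
      refine Eventually.of_forall fun z => ?_
      rw [norm_smul, Real.norm_eq_abs, abs_of_nonneg (hθ0 z)]
      exact mul_le_mul_of_nonneg_left (norm_integral_probeBump_smul_le hM _ hR) (hθ0 z)
    · refine Eventually.of_forall fun z => ?_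
      have := (tendsto_integral_probeBump_smul hc hM (x₁ - z) (hav (x₁ - z))).const_smul (θ z)
      simpa using this
  rw [integral_zero] at hlim
  refine hlim.congr' ?_
  filter_upwards [eventually_gt_atTop (0 : ℝ)] with R hR using (hident R hR).symm

end ProbeWeight

end Literature.Analysis.FluidPDE

end
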